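import Literature.NumberTheory.Automorphic.Liu2021.AppendixC.RestOneHecke
import Literature.NumberTheory.Automorphic.Liu2021.AppendixC.Prop413DataOfRestOne
import Literature.NumberTheory.Automorphic.Liu2021.Thm418Transport
import Mathlib.Topology.Algebra.ClopenNhdofOne
import HarnessLib

/-!
# [Liu2021, Thm. 4.18 (1)] for the one-object Hecke datum, REDUCED to two statements about the Albanese tower

[Liu2021] = Yifeng Liu, *Fourier–Jacobi cycles and arithmetic relative trace formula*, Camb. J. Math. **9** (2021) 1–147 =
arXiv:2102.11518; `l. NNNN` = lines of the author's TeX source `FJcycle.tex` (arXiv v2, md5 `6db49a74122d`), as in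
`AppendixC/Glue.lean`.  PROOF FILE over the carriers of `AppendixC/RestOne.lean` (S1: `Ω(μ) = colim_K ℚ ⊗ Hom_E(A_K, A_μ)`,
`res_K = DirectLimit.of`) and `AppendixC/RestOneHecke.lean` (the Hecke action `heckeRep ∕ rhoΩOne` CONSTRUCTED from Hecke translates
`T : C.HeckeTranslates`): theorems, plus TWO hypothesis PREDICATES on the datum (§3); no named fact, no instance, no `sorry`.
HC_CM is NOT proved; nothing here discharges a binder by itself.

## The printed text

Thm. 4.18 (1) (l. 2239): «For every object `D_μ = (A_μ, i_μ, λ_μ, r_μ) ∈ 𝒜(μ)`, we have a canonical isomorphism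
`Ω(μ)^K ≃ Hom_E(A_K, A_μ)_ℚ` for every sufficiently small open compact subgroup `K ⊆ 𝔾(𝔸_F^∞)`.»  Proof (l. 2270): «The additional
statement (1) follows from the above discussion as well» (the discussion = the map (4.3), Faltings' isogeny theorem and the Galois
decomposition of `H¹_{ét}(A_∞)`; Rem. 4.17: `Ω(μ) = Hom_E(A_∞, A_μ)_ℚ`, `A_∞ = lim_K A_K`, l. 2072).

## What this file proves

In the tree `Ω(μ)` at the one object is the direct limit `RestOne.ΩOf C B S = colim_{K ≤ K₀} ℚ ⊗_ℤ Hom_E(A_K, B)` along the pull-backs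
`Alb_{u^{K'}_K}^*` (`RestOne.sys`), `res_K = Module.DirectLimit.of` (`RestOne.resOf`), and `g ∈ 𝔾(𝔸_F^∞)` acts by
`g · res_K t = res_L (Alb(T_g : X_L → X_K)^* t)` (`HeckeTranslates.heckeRep_resOf`).  Item (1) AS TYPED in `Thm418AsPrinted`
(`res K D_μ` injective with image the `K`-invariants, READING R5) is therefore EQUIVALENT, by colimit bookkeeping, to two statements
about the Albanese tower `{A_K}_K` at FINITE level, which this file isolates as predicates (§3) and ASSUMES:

* (I) `Sec42Data.PullInjective C` — `ℚ ⊗ Hom_E(A_K, B) → ℚ ⊗ Hom_E(A_{K'}, B)`, `φ ↦ Alb_{u^{K'}_K} ≫ φ`, is injective for `K' ⊆ K`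
  (for Liu's tower: `u^{K'}_K` is a finite surjection, so `Alb_u` is onto — Def. 2.3, §4.2 l. 2064 «generically finite dominant»);
* (D) `Sec42Data.HeckeTranslates.LevelDescent T` — for `N ⊆ K` with `N` normalised by `K`, a class in `ℚ ⊗ Hom_E(A_N, B)` fixed by
  every `Alb(T_k)^*`, `k ∈ K`, is pulled back from `ℚ ⊗ Hom_E(A_K, B)` (for Liu's tower: `X_N → X_K` is the quotient by `K/N`, and
  `Alb(X_N)_{K/N} → Alb(X_K)` is an isogeny — the finite-level content of item (1), cf. Lem. 2.4 (1) `H¹(Alb_X) ≅ H¹(X)`).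

From (I) and (D), with NO further input:
* §1 `C5.SmallLevel.exists_le_le`, `C5.SmallLevel.exists_normal_le` — common refinements of levels; inside a level `K` every level
  contains one NORMALISED by `K` (the open subgroup `K ∩ K₁` of the COMPACT group `K` contains an open normal subgroup of `K`:
  Mathlib `IsTopologicalGroup.exist_openNormalSubgroup_sub_clopen_nhds_of_one`; no total-disconnectedness needed);
* §2 `RestOne.isDirectedOrder_idx`, `nonempty_idx`, `directedSystem_sys` — the index of levels is directed and `K ↦ ℚ ⊗ Hom_E(A_K, B)`
  is a `DirectedSystem` (functoriality `Atr_id ∕ Atr_comp`), so Mathlib's `Module.DirectLimit.exists_of ∕ of.zero_exact` apply;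
* §4 `Sec42Data.resOf_injective` ((I) ⇒ `res_K` injective), `HeckeTranslates.range_resOf_eq` ((I)+(D) ⇒ `range res_K` = the
  `K`-invariants of `heckeRep`: a class lives at some level, is moved to a level `N ⊆ K` normalised by `K`, its invariance in the
  colimit is invariance at level `N` by injectivity, and (D) descends it);
* §5 at the one object (`ΩOne = Π_{ObjOne} ΩOf`, `ObjOne` a subsingleton): `Sec42Data.resOne_injective`, `HeckeTranslates.range_resOne_eq`;
* §6 **`levelInvariants_toThm418Data_rest_restTailOne`** — item (1) AS TYPED for the datum
  `toThm418Data C (U.rest (restTailOne φ ι hμ hw Car (T.rhoΩOne φ ι hμ hw Car)))` (any μ-uniform theta-side family `U`), threshold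
  `K₀` = that of the system `C.S` (`levelOf K = K` there, `Sec42Data.coe_levelOf`); and
  **`levelInvariants_transport_toThm418Data_rest_restTailOne`** — the same for every transport `Thm418Data.transport` of that datum
  along an isomorphism `ψ : G′ ≃ 𝔾(𝔸_F^∞)` (threshold `ψ⁻¹(K₀)`, `Thm418Data.invariants_transport`) — the shape in which the COR-CM headline
  reads the `hLiu418` row at the conjugate space.
The conclusions are stated UNFOLDED (`∀ D_μ, ∃ K₀ open compact, ∀ K open compact ≤ K₀, Injective (res K D_μ) ∧ range (res K D_μ) =
invariants K`), i.e. literally conjunct (1) of `Thm418AsPrinted`.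

Deliberately NOT here: proofs of (I)/(D) for a particular tower (Albanese geometry of the canonical-model tower); items (2), (3), main iso.

References: [Liu2021] Thm. 4.18 (1) l. 2239, proof l. 2247–2270, Rem. 4.17, §4.2 l. 2062–2074, Def. 2.3, Lem. 2.4 (1);
[Milne2005ShimuraVarieties] §5 p. 57–58 (Hecke action `T(g)`, the level acts trivially).
-/
set_option autoImplicit false

noncomputable section

open CategoryTheory NumberField
open scoped TensorProduct

namespace Literature.NumberTheory.Automorphic.Liu2021.AppendixC

/-! ## §1. Small levels: common refinements and normal refinements -/
namespace C5.SmallLevel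

variable {H : Type} [Group H] [TopologicalSpace H] [IsTopologicalGroup H] {K₀ : OpenCompactSubgroup H}

/-- Two sufficiently small levels have a common refinement (their intersection) — the index of «sufficiently small open compact
subgroups `K`» (l. 2060) is (co)directed. [cite: Liu2021, §4.2 FJcycle.tex l. 2060–2072] -/
theorem exists_le_le (K K' : SmallLevel K₀) : ∃ L : SmallLevel K₀, L ≤ K ∧ L ≤ K' := by
  refine ⟨⟨⟨K.1.1 ⊓ K'.1.1, ?_, ?_⟩, le_trans (inf_le_left : K.1.1 ⊓ K'.1.1 ≤ K.1.1) K.2⟩,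
    (inf_le_left : K.1.1 ⊓ K'.1.1 ≤ K.1.1), (inf_le_right : K.1.1 ⊓ K'.1.1 ≤ K'.1.1)⟩
  · simpa only [Subgroup.coe_inf] using K.1.2.1.inter K'.1.2.1
  · simpa only [Subgroup.coe_inf] using K.1.2.2.inter_right (Subgroup.isClosed_of_isOpen _ K'.1.2.1)

/-- For sufficiently small levels `K`, `K₁` there is a level `N ⊆ K ∩ K₁` NORMALISED by `K` (`k⁻¹ N k ⊆ N` for
`k ∈ K`): the open subgroup `K ∩ K₁` of the compact group `K` contains an open normal subgroup of `K`
(Mathlib `IsTopologicalGroup.exist_openNormalSubgroup_sub_clopen_nhds_of_one`); used to read the `K`-invariants at a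
`K`-stable level. [cite: Liu2021, §4.2 FJcycle.tex l. 2060–2074 and Thm. 4.18 (1) l. 2239] -/
theorem exists_normal_le (K K₁ : SmallLevel K₀) :
    ∃ N : SmallLevel K₀, N ≤ K ∧ N ≤ K₁ ∧ ∀ k ∈ K.1.1, HeckeLE k N N := by
  haveI : CompactSpace K.1.1 := isCompact_iff_compactSpace.1 K.1.2.2
  -- the trace of `K₁` on `K`, an open subgroup of the compact group `K`
  let W : OpenSubgroup K.1.1 :=
    ⟨K₁.1.1.subgroupOf K.1.1, K₁.1.2.1.preimage continuous_subtype_val⟩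
  obtain ⟨N₀, hN₀⟩ := IsTopologicalGroup.exist_openNormalSubgroup_sub_clopen_nhds_of_one
    (G := K.1.1) (W := (W : Set K.1.1)) W.isClopen (one_mem W)
  have hN₀W : ∀ x : K.1.1, x ∈ N₀.toSubgroup → (x : H) ∈ K₁.1.1 := fun x hx => hN₀ hx
  -- push `N₀` forward to `H`
  let N : Subgroup H := N₀.toSubgroup.map K.1.1.subtype
  have hNK₁ : N ≤ K₁.1.1 := by
    rintro _ ⟨x, hx, rfl⟩
    exact hN₀W x hx
  have hNK : N ≤ K.1.1 := by
    rintro _ ⟨x, _, rfl⟩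
    exact x.2
  have hNopen : IsOpen (N : Set H) := by
    have : (N : Set H) = Subtype.val '' (N₀ : Set K.1.1) := Subgroup.coe_map _ _
    rw [this]
    exact K.1.2.1.isOpenMap_subtype_val _ N₀.isOpen
  have hNcpt : IsCompact (N : Set H) := by
    have : (N : Set H) = Subtype.val '' (N₀ : Set K.1.1) := Subgroup.coe_map _ _
    rw [this]
    exact (N₀.toOpenSubgroup.isClosed.isCompact).image continuous_subtype_val
  refine ⟨⟨⟨N, hNopen, hNcpt⟩, le_trans hNK K.2⟩, hNK, hNK₁, fun k hk => ?_⟩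
  rintro _ ⟨x, hx, rfl⟩
  refine ⟨⟨k, hk⟩⁻¹ * x * ⟨k, hk⟩, ?_, rfl⟩
  have := N₀.isNormal'.conj_mem x hx ⟨k, hk⟩⁻¹
  simpa using this

end C5.SmallLevel

/-! ## §2. The direct system `K ↦ ℚ ⊗ Hom_E(A_K, B)` is directed -/
namespace RestOne

variable {F E : Type} [Field F] [NumberField F] [IsTotallyReal F] [Field E] [NumberField E] [Algebra F E]
  [IsTotallyComplex E] [Algebra.IsQuadraticExtension F E]
variable {P5 : PropC5Data F E} {isotropicAt : ℕ → Prop} (C : Sec42Data P5 isotropicAt)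
variable (B : Literature.AlgebraicGeometry.Motives.AbelianVariety E) (S : Type) [Ring S] [EndScalar S B]

/-- The reversed index of levels is directed (common refinements exist), so `colim_K ℚ ⊗ Hom_E(A_K, B)` (`A_∞ = lim_K A_K`, l. 2072)
is a DIRECTED colimit. [cite: Liu2021, §4.2 FJcycle.tex l. 2070–2072] -/
theorem isDirectedOrder_idx : IsDirectedOrder (Idx C) := by
  refine ⟨fun i j => ?_⟩
  obtain ⟨L, hLi, hLj⟩ := C5.SmallLevel.exists_le_le (OrderDual.ofDual i) (OrderDual.ofDual j)
  exact ⟨OrderDual.toDual L, hLi, hLj⟩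

/-- The reversed index of levels is inhabited (by the threshold `K₀`). [cite: Liu2021, §4.2 FJcycle.tex l. 2060–2072] -/
theorem nonempty_idx : Nonempty (Idx C) := ⟨OrderDual.toDual ⟨C.S.K₀, le_rfl⟩⟩

/-- The direct system of pull-backs `Alb_u^*` is a directed system (functoriality of `{A_K}_K`).
[cite: Liu2021, §4.2 FJcycle.tex l. 2070–2072] -/
theorem directedSystem_sys : DirectedSystem (sysObj C B) (sys C B S · · ·) where
  map_self i t := by
    show preₛ B S (C.Atr (homOfLE _)) t = t
    rw [preₛ_apply]
    have hid : (homOfLE (le_refl (OrderDual.ofDual i)) : OrderDual.ofDual i ⟶ OrderDual.ofDual i) = 𝟙 _ := rfl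
    rw [hid, C.Atr_id]
    exact pre_id B t
  map_map {k j i} hij hjk t := by
    show preₛ B S (C.Atr (homOfLE _)) (preₛ B S (C.Atr (homOfLE _)) t) = preₛ B S (C.Atr (homOfLE _)) t
    simp only [preₛ_apply]
    rw [pre_pre, ← C.Atr_comp]
    rfl

end RestOne

/-! ## §3. The two geometric inputs, as predicates on the Appendix-C datum and its Hecke translates -/
section Inputs

variable {F E : Type} [Field F] [NumberField F] [IsTotallyReal F] [Field E] [NumberField E] [Algebra F E]
  [IsTotallyComplex E] [Algebra.IsQuadraticExtension F E]
variable {P5 : PropC5Data F E} {isotropicAt : ℕ → Prop}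

/-- **INPUT (I) — pull-back along the Albanese transition maps is injective on rational Hom groups**: for
sufficiently small levels `K' ⊆ K` and every abelian variety `B` over `E`, the map
`ℚ ⊗ Hom_E(A_K, B) → ℚ ⊗ Hom_E(A_{K'}, B)`, `φ ↦ Alb_{u^{K'}_K} ≫ φ`, is injective (it is whenever `Alb_{u^{K'}_K}` is an
epimorphism, e.g. when `u^{K'}_K : X_{K'} → X_K` is dominant).  A PREDICATE on the datum `C` (not asserted).
[cite: Liu2021, §4.2 FJcycle.tex l. 2070–2072 and Thm. 4.18 (1) l. 2239] -/
def Sec42Data.PullInjective (C : Sec42Data P5 isotropicAt) : Prop :=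
  ∀ ⦃K K' : C5.SmallLevel C.S.K₀⦄ (f : K' ⟶ K) (B : Literature.AlgebraicGeometry.Motives.AbelianVariety E),
    Function.Injective (RestOne.pre B (C.Atr f))

/-- **INPUT (D) — Hecke-invariant classes descend one level**: for sufficiently small levels `N ⊆ K` with `N`
normalised by `K`, every class `t ∈ ℚ ⊗ Hom_E(A_N, B)` fixed by all `Alb(T_k)^*`, `k ∈ K` (`T_k : X_N → X_N` the Hecke
translate), is pulled back from `ℚ ⊗ Hom_E(A_K, B)` along `Alb_{u^N_K}` (Galois descent for the cover `X_N → X_K` read on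
Albanese varieties up to isogeny).  A PREDICATE on `(C, T)` (not asserted).
[cite: Liu2021, Thm. 4.18 (1) FJcycle.tex l. 2239 and Lem. 2.4 (1)] -/
def Sec42Data.HeckeTranslates.LevelDescent {C : Sec42Data P5 isotropicAt} (T : C.HeckeTranslates) : Prop :=
  ∀ ⦃N K : C5.SmallLevel C.S.K₀⦄ (h : N ≤ K) (hn : ∀ k ∈ K.1.1, C5.HeckeLE k N N)
    (B : Literature.AlgebraicGeometry.Motives.AbelianVariety E) (t : RestOne.QHom (C.A N) B),
    (∀ (k : C.G) (hk : k ∈ K.1.1), RestOne.pre B (T.albTr k N N (hn k hk)) t = t) →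
      t ∈ Set.range (RestOne.pre B (C.Atr (homOfLE h)))

end Inputs

/-! ## §4. `res_K` is injective with image the `K`-invariants, on `Hom_E(A_∞, B)_ℚ` -/
namespace Sec42Data

variable {F E : Type} [Field F] [NumberField F] [IsTotallyReal F] [Field E] [NumberField E] [Algebra F E]
  [IsTotallyComplex E] [Algebra.IsQuadraticExtension F E]
variable {P5 : PropC5Data F E} {isotropicAt : ℕ → Prop} (C : Sec42Data P5 isotropicAt)
variable (B : Literature.AlgebraicGeometry.Motives.AbelianVariety E) (S : Type) [Ring S] [RestOne.EndScalar S B]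

open RestOne (QHom pre preₛ Idx sysObj sys ΩOf resOf)
open scoped Literature.NumberTheory.Automorphic.Liu2021.AppendixC.RestOne
open scoped Classical

/-- **`res_K : ℚ ⊗ Hom_E(A_K, B) → Hom_E(A_∞, B)_ℚ` is injective** at every sufficiently small level, given INPUT (I)
(a directed colimit with injective transition maps). [cite: Liu2021, Thm. 4.18 (1) FJcycle.tex l. 2239] -/
theorem resOf_injective (hI : C.PullInjective) (K : C5.SmallLevel C.S.K₀) :
    Function.Injective (resOf C B S K) := by
  haveI := RestOne.isDirectedOrder_idx C
  haveI := RestOne.directedSystem_sys C B S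
  refine (injective_iff_map_eq_zero (resOf C B S K)).2 fun t ht => ?_
  obtain ⟨j, hij, hj⟩ := Module.DirectLimit.of.zero_exact
    (R := S) (ι := Idx C) (G := sysObj C B) (f := sys C B S) (i := OrderDual.toDual K) (x := t) ht
  have hle : OrderDual.ofDual j ≤ K := hij
  have hj' : pre B (C.Atr (homOfLE hle)) t = 0 := hj
  exact hI (homOfLE hle) B (a₁ := t) (a₂ := 0) (by rw [hj', map_zero])

end Sec42Data

namespace Sec42Data.HeckeTranslates

variable {F E : Type} [Field F] [NumberField F] [IsTotallyReal F] [Field E] [NumberField E] [Algebra F E]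
  [IsTotallyComplex E] [Algebra.IsQuadraticExtension F E]
variable {P5 : PropC5Data F E} {isotropicAt : ℕ → Prop} {C : Sec42Data P5 isotropicAt} (T : C.HeckeTranslates)
variable (B : Literature.AlgebraicGeometry.Motives.AbelianVariety E) (S : Type) [Ring S] [RestOne.EndScalar S B]

open RestOne (QHom pre preₛ Idx sysObj sys ΩOf resOf)
open scoped Literature.NumberTheory.Automorphic.Liu2021.AppendixC.RestOne
open scoped Classical

/-- `res_K` lands in the `K`-invariants (by construction of the Hecke action) and, given INPUTS (I) and (D), EVERY
`K`-invariant class of `Hom_E(A_∞, B)_ℚ` is a `res_K`-image: **`range res_K = (Hom_E(A_∞, B)_ℚ)^K`**.  Proof: a class lives at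
some level; refine to a level `N ⊆ K` normalised by `K` (compactness of `K`); invariance in the colimit is invariance at level
`N` by injectivity; descend to `K` by (D). [cite: Liu2021, Thm. 4.18 (1) FJcycle.tex l. 2239] -/
theorem range_resOf_eq (hI : C.PullInjective) (hD : T.LevelDescent) (K : C5.SmallLevel C.S.K₀) :
    Set.range (resOf C B S K) = {x | ∀ k ∈ K.1.1, T.heckeRep B S k x = x} := by
  haveI := RestOne.isDirectedOrder_idx C
  haveI := RestOne.nonempty_idx C
  haveI := RestOne.directedSystem_sys C B S
  ext x
  constructor
  · rintro ⟨t, rfl⟩ k hk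
    exact T.heckeRep_resOf_of_mem B S hk t
  · intro hx
    obtain ⟨i, t₀, ht₀⟩ := Module.DirectLimit.exists_of (R := S) (ι := Idx C) (G := sysObj C B) (f := sys C B S) x
    obtain ⟨N, hNK, hNi, hN⟩ := C5.SmallLevel.exists_normal_le K (OrderDual.ofDual i)
    -- move the representative to the level `N`
    set t : QHom (C.A N) B := pre B (C.Atr (homOfLE hNi)) t₀ with ht
    have hxt : resOf C B S N t = x := by
      rw [← ht₀, ht, ← RestOne.pull_eq_pre]
      exact RestOne.resOf_pull C B S (homOfLE hNi) t₀
    -- invariance at level `N`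
    have hinv : ∀ (k : C.G) (hk : k ∈ K.1.1), pre B (T.albTr k N N (hN k hk)) t = t := by
      intro k hk
      apply Sec42Data.resOf_injective C B S hI N
      rw [← T.heckeRep_resOf B S k (hN k hk) t, hxt]
      exact hx k hk
    obtain ⟨s, hs⟩ := hD hNK hN B t hinv
    refine ⟨s, ?_⟩
    rw [← hxt, ← hs, ← RestOne.pull_eq_pre]
    exact (RestOne.resOf_pull C B S (homOfLE hNK) s).symm

end Sec42Data.HeckeTranslates

/-! ## §5. At the one object: `res_K D` injective with image `Ω(μ)^K` -/
namespace Sec42Data.HeckeTranslates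

variable {F E : Type} [Field F] [NumberField F] [IsTotallyReal F] [Field E] [NumberField E] [Algebra F E]
  [IsTotallyComplex E] [Algebra.IsQuadraticExtension F E] [IsCMField E]
variable {P5 : PropC5Data F E} {isotropicAt : ℕ → Prop} {C : Sec42Data P5 isotropicAt} (T : C.HeckeTranslates)
variable {L : Type} [Field L] [NumberField L] [IsGalois ℚ L] (φ : E →ₐ[ℚ] L) (ι : L →+* ℂ)
variable {μ : IdeleClassGroup E →ₜ* Circle} (hμ : IdeleClassGroup.IsConjugateSymplectic E μ)
  (hw : IdeleClassGroup.HasWeight E μ 1) (Car : Def45.Carriers E μ)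

open RestOne (QHom pre ObjOne AμOne ΩOne resOne resOf)
open scoped Literature.NumberTheory.Automorphic.Liu2021.AppendixC.RestOne

/-- At the one object, `res_K D : ℚ ⊗ Hom_E(A_K, A_μ) → Ω(μ)` is injective, given INPUT (I).
[cite: Liu2021, Thm. 4.18 (1) FJcycle.tex l. 2239] -/
theorem _root_.Literature.NumberTheory.Automorphic.Liu2021.AppendixC.Sec42Data.resOne_injective
    (C : Sec42Data P5 isotropicAt) (hI : C.PullInjective) (K : C5.SmallLevel C.S.K₀) (D : ObjOne φ ι hμ hw Car) :
    Function.Injective (resOne C φ ι hμ hw Car K D) := fun _ _ h =>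
  Sec42Data.resOf_injective C (AμOne φ ι hμ hw Car D) (fieldOfValues E μ) hI K (congr_fun h D)

/-- At the one object, **`range (res_K D) = Ω(μ)^K`** for the constructed Hecke action `rhoΩOne`, given INPUTS (I) and (D)
— [Liu2021, Thm. 4.18 (1)] «`Ω(μ)^K ≃ Hom_E(A_K, A_μ)_ℚ`» at every sufficiently small `K`, REDUCED to (I) + (D).
[cite: Liu2021, Thm. 4.18 (1) FJcycle.tex l. 2239] -/
theorem range_resOne_eq (hI : C.PullInjective) (hD : T.LevelDescent) (K : C5.SmallLevel C.S.K₀)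
    (D : ObjOne φ ι hμ hw Car) :
    Set.range (resOne C φ ι hμ hw Car K D) = {x | ∀ k ∈ K.1.1, T.rhoΩOne φ ι hμ hw Car k x = x} := by
  ext x
  constructor
  · rintro ⟨t, rfl⟩ k hk
    exact T.rhoΩOne_resOne_of_mem φ ι hμ hw Car hk D t
  · intro hx
    have hxD : x D ∈ Set.range (resOf C (AμOne φ ι hμ hw Car D) (fieldOfValues E μ) K) := by
      rw [T.range_resOf_eq (AμOne φ ι hμ hw Car D) (fieldOfValues E μ) hI hD K]
      intro k hk
      have := congr_fun (hx k hk) D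
      rwa [T.rhoΩOne_apply φ ι hμ hw Car] at this
    obtain ⟨t, ht⟩ := hxD
    refine ⟨t, funext fun D' => ?_⟩
    obtain rfl : D' = D := Subsingleton.elim _ _
    exact ht

end Sec42Data.HeckeTranslates

/-! ## §6. [Liu2021, Thm. 4.18 (1)] for the one-object Hecke datum and its transports, from (I) + (D) -/

section Datum

variable {F E : Type} [Field F] [NumberField F] [IsTotallyReal F] [Field E] [NumberField E] [Algebra F E]
  [IsTotallyComplex E] [Algebra.IsQuadraticExtension F E] [IsCMField E]
variable {P5 : PropC5Data F E} {isotropicAt : ℕ → Prop} {C : Sec42Data P5 isotropicAt} (T : C.HeckeTranslates)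
  (U : UniformOmega C)
variable {L : Type} [Field L] [NumberField L] [IsGalois ℚ L] (φ : E →ₐ[ℚ] L) (ι : L →+* ℂ)
variable {μ : IdeleClassGroup E →ₜ* Circle} (hμ : IdeleClassGroup.IsConjugateSymplectic E μ)
  (hw : IdeleClassGroup.HasWeight E μ 1) (Car : Def45.Carriers E μ)

open RestOne (ObjOne resOne)
open scoped Literature.NumberTheory.Automorphic.Liu2021.AppendixC.RestOne

/-- **[Liu2021, Thm. 4.18 (1)] AS TYPED (`LevelInvariants`) for the one-object Hecke datum
`toThm418Data C (U.rest (restTailOne φ ι hμ hw Car (T.rhoΩOne φ ι hμ hw Car)))`, from INPUTS (I) and (D)**: for every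
object `D_μ` and every open compact `K ≤ K₀` (the threshold of the system `C.S`), `res K D_μ` is injective with image the
`K`-invariants `Ω(μ)^K`.  (At an open compact `K ≤ K₀`, `levelOf K = K`, `Sec42Data.coe_levelOf`.)
[cite: Liu2021, Thm. 4.18 (1) FJcycle.tex l. 2239; Rem. 4.17] -/
theorem levelInvariants_toThm418Data_rest_restTailOne (hI : C.PullInjective) (hD : T.LevelDescent) :
    ∀ Dμ : (toThm418Data C (U.rest (restTailOne φ ι hμ hw Car (T.rhoΩOne φ ι hμ hw Car)))).Obj,
      ∃ K₀ : Subgroup (toThm418Data C (U.rest (restTailOne φ ι hμ hw Car (T.rhoΩOne φ ι hμ hw Car)))).G,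
        IsOpenCompact K₀ ∧
        ∀ K : Subgroup (toThm418Data C (U.rest (restTailOne φ ι hμ hw Car (T.rhoΩOne φ ι hμ hw Car)))).G,
          IsOpenCompact K → K ≤ K₀ →
            Function.Injective
                ((toThm418Data C (U.rest (restTailOne φ ι hμ hw Car (T.rhoΩOne φ ι hμ hw Car)))).res K Dμ) ∧
              Set.range ((toThm418Data C (U.rest (restTailOne φ ι hμ hw Car (T.rhoΩOne φ ι hμ hw Car)))).res K Dμ) =
                (toThm418Data C (U.rest (restTailOne φ ι hμ hw Car (T.rhoΩOne φ ι hμ hw Car)))).invariants K := by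
  intro Dμ
  refine ⟨C.S.K₀.1, C.S.K₀.2, fun K hK hle => ?_⟩
  have hcoe : ((C.levelOf K).1.1 : Subgroup C.G) = K := C.coe_levelOf hK hle
  refine ⟨C.resOne_injective φ ι hμ hw Car hI (C.levelOf K) Dμ, ?_⟩
  show Set.range (resOne C φ ι hμ hw Car (C.levelOf K) Dμ) = {x | ∀ k ∈ K, T.rhoΩOne φ ι hμ hw Car k x = x}
  rw [T.range_resOne_eq φ ι hμ hw Car hI hD (C.levelOf K) Dμ, hcoe]
  rfl

variable (G' : Type) [Group G'] [TopologicalSpace G'] [IsTopologicalGroup G'] (ψ : G' ≃ₜ* C.G)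
  (Eps' : Type) (epsOf' : E → Eps') (Chi' : Type) (omega' : Eps' → Chi' → Type)
  [∀ ε χ, AddCommGroup (omega' ε χ)] [∀ ε χ, Module ℂ (omega' ε χ)]
  (rho' : ∀ ε χ, Representation ℂ G' (omega' ε χ))

omit [IsCMField E] [IsTopologicalGroup G'] in
/-- an open compact subgroup maps to an open compact subgroup under a topological-group isomorphism. [folklore] -/
private theorem isOpenCompact_map' {K' : Subgroup G'} (hK : IsOpenCompact K') :
    IsOpenCompact (K'.map ψ.toMulEquiv.toMonoidHom : Subgroup C.G) := by
  have hcoe : ((K'.map ψ.toMulEquiv.toMonoidHom : Subgroup C.G) : Set C.G) = ψ.toHomeomorph '' (K' : Set G') :=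
    Subgroup.coe_map _ _
  refine ⟨?_, ?_⟩
  · rw [hcoe]
    exact ψ.toHomeomorph.isOpenMap _ hK.1
  · rw [hcoe]
    exact hK.2.image ψ.toHomeomorph.continuous

omit [IsCMField E] [IsTopologicalGroup G'] in
/-- the preimage of an open compact subgroup under a topological-group isomorphism is open compact. [folklore] -/
private theorem isOpenCompact_comap' {K : Subgroup C.G} (hK : IsOpenCompact K) :
    IsOpenCompact (K.comap ψ.toMulEquiv.toMonoidHom : Subgroup G') := by
  have hset : ((K.comap ψ.toMulEquiv.toMonoidHom : Subgroup G') : Set G') = ψ.toHomeomorph ⁻¹' (K : Set C.G) := rfl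
  refine ⟨?_, ?_⟩
  · rw [hset]
    exact hK.1.preimage ψ.toHomeomorph.continuous
  · rw [hset, ψ.toHomeomorph.isCompact_preimage]
    exact hK.2

/-- **[Liu2021, Thm. 4.18 (1)] AS TYPED (`LevelInvariants`) for every TRANSPORT of the one-object Hecke datum along an
isomorphism `ψ : G′ ≃ 𝔾(𝔸_F^∞)` (new collections, characters and summands arbitrary), from INPUTS (I) and (D)**: levels are
read through `ψ` (`Hom_E(A_{K′}, A_μ)_ℚ := Hom_E(A_{ψ(K′)}, A_μ)_ℚ`, `Ω(μ)^{K′} = Ω(μ)^{ψ(K′)}`, `Thm418Data.invariants_transport`);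
threshold `K₀′ := ψ⁻¹(K₀)`. [cite: Liu2021, Thm. 4.18 (1) FJcycle.tex l. 2239; Rem. 4.17] -/
theorem levelInvariants_transport_toThm418Data_rest_restTailOne (hI : C.PullInjective) (hD : T.LevelDescent) :
    ∀ Dμ : ((toThm418Data C (U.rest (restTailOne φ ι hμ hw Car (T.rhoΩOne φ ι hμ hw Car)))).transport
        G' ψ Eps' epsOf' Chi' omega' rho').Obj,
      ∃ K₀ : Subgroup ((toThm418Data C (U.rest (restTailOne φ ι hμ hw Car (T.rhoΩOne φ ι hμ hw Car)))).transport
          G' ψ Eps' epsOf' Chi' omega' rho').G,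
        IsOpenCompact K₀ ∧
        ∀ K : Subgroup ((toThm418Data C (U.rest (restTailOne φ ι hμ hw Car (T.rhoΩOne φ ι hμ hw Car)))).transport
            G' ψ Eps' epsOf' Chi' omega' rho').G,
          IsOpenCompact K → K ≤ K₀ →
            Function.Injective
                (((toThm418Data C (U.rest (restTailOne φ ι hμ hw Car (T.rhoΩOne φ ι hμ hw Car)))).transport
                  G' ψ Eps' epsOf' Chi' omega' rho').res K Dμ) ∧
              Set.range (((toThm418Data C (U.rest (restTailOne φ ι hμ hw Car (T.rhoΩOne φ ι hμ hw Car)))).transport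
                  G' ψ Eps' epsOf' Chi' omega' rho').res K Dμ) =
                ((toThm418Data C (U.rest (restTailOne φ ι hμ hw Car (T.rhoΩOne φ ι hμ hw Car)))).transport
                  G' ψ Eps' epsOf' Chi' omega' rho').invariants K := by
  intro Dμ
  obtain ⟨K₀, hK₀, hK⟩ := levelInvariants_toThm418Data_rest_restTailOne T U φ ι hμ hw Car hI hD Dμ
  refine ⟨K₀.comap ψ.toMulEquiv.toMonoidHom, isOpenCompact_comap' G' ψ hK₀, fun K' hK' hle => ?_⟩
  have hle' : K'.map ψ.toMulEquiv.toMonoidHom ≤ K₀ := Subgroup.map_le_iff_le_comap.2 hle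
  obtain ⟨hinj, hrange⟩ := hK (K'.map ψ.toMulEquiv.toMonoidHom) (isOpenCompact_map' G' ψ hK') hle'
  refine ⟨hinj, ?_⟩
  rw [Thm418Data.invariants_transport]
  exact hrange

end Datum

end Literature.NumberTheory.Automorphic.Liu2021.AppendixC

end
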